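import Summits.BirchSwinnertonDyer.Rank1Residual.F1Sign2.HondaSystemAtTwo
import Literature.NumberTheory.EllipticCurves.Sprung2012.HondaSystemExistsHolds
import HarnessLib

/-!
# Sprung's Honda system AT `p = 2`, I: `IsHondaSystemAtTwo` from PRIMAL Honda data — the four dual generation
# clauses at `2` (the `p = 2` twin of `Sprung2012.Honda.SprungHonda.isHondaSystem_of_primal`)

Seat `bsd-2adic-tower-1` GEN 66, hand H2-C1 (pen GEN 40 SUMMON 20260831T155847Z): kernel theorems toward (C1)
`Summit.BirchSwinnertonDyer.Rank1Residual.F1Sign2.HondaSystemAtTwoExists` (crux `SupersingularRankZeroAtTwo`, item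
stmt-BirchSwinnertonDyer-19097, line `odd_blind_package` v2.14, stub 2 conjuncts (1)–(6) ⟸ (C1) by `p827135`).

WHAT (THEOREMS ONLY; no definition, no named fact, no instance, no `sorry`; route-independent: no `Theses` import).
For `K ⊆ E` fields, `κ` a `ℤ_p`-extension of `K`, `ι : K̄ → Ē`, `W/K`:
* §1 (any prime `p`) `pow_dvd_evalOn_orbit_of_relations_of_isUnit` — ORBIT PROPAGATION through the trace relations
  `Tr_{m+1/m} c_{m+1} = a•c_m − c_{m−1}` (`m ≥ 1`) and a bottom relation `c_0 = u•cneg` with `u` ANY `p`-adic unit: a functional `z`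
  on `E(K_n·E)` with `p^K ∣ z(gʲ•c_n)`, `p^K ∣ z(gʲ•c_{n−1})` (`j < pⁿ`) has `p^K ∣ z(σ•c_m)` for all `σ`, `m ≤ n`, and `p^K ∣ z(cneg)`.
  The tree's `SprungHonda.pow_dvd_evalOn_orbit_of_relations` is the case `u = a_p − 2` (a unit only for ODD `p`); at `p = 2` the bottom
  relation of `F1Sign2.IsHondaSystemAtTwo` has `u = a₂² − 2a₂ − 1 ∈ {−1, −1, 7}`. Same proof.
* §2 (`p = 2`) **`isHondaSystemAtTwo_of_primal`**: PRIMAL data — levels, `c 0 = (a² − 2a − 1)•cneg`,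
  `Tr_{1/0} c_1 = a•c_0 + (4 − 2a)•cneg`, `Tr_{n+1/n} c_{n+1} = a•c_n − c_{n−1}` (`n ≥ 1`), generation
  `N•P ∈ ℤ[Γ·c_m] + E(K_{m−1}·E) + 2·E(K_m·E)` (`m ≥ 1`) and `N•P ∈ ℤ·cneg + 2·E(E)` with `N` odd — IMPLY
  `F1Sign2.IsHondaSystemAtTwo κ ι W a g cneg c` (the four dual clauses are token-identical with `Sprung2012.IsHondaSystem` at
  `p = 2`; the engines `SprungHonda.pow_dvd_evalOn_of_generation`, `…forall_eq_zero_of_omega_dvd_sum`,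
  `…forall_dvd_of_omega_dvd_C_mul_sub_sum`, `…omega_dvd_of_omega_dvd_C_mul`, `…exists_eq_smul_of_forall_dvd` are `p`-generic).
HONEST FRAMING: pure algebra of functionals on layer points; closes no item; BSD is not proved by any of this.

References: [Sprung2012] F. Sprung, J. Number Theory 132 (2012), Thm. 2.2 (p. 1487), Cor. 2.10 (p. 1489); [Kobayashi2003]
S. Kobayashi, Invent. Math. 152 (2003), Lemma 8.9, Prop. 8.12; cell memo MEMO-imc §10.90 / REF1 §139 (B0), R3 (the `p = 2` bottom constants).
-/

set_option autoImplicit false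
-- the Theorems namespace of this sub repeats the summit name by design (D-0017 nested layout)
set_option linter.dupNamespace false

noncomputable section

open scoped Classical
open Finset

universe u

namespace Summit.BirchSwinnertonDyer.BirchSwinnertonDyer.Theorems.SSHondaTwo

open Literature.NumberTheory.EllipticCurves Literature.NumberTheory.GaloisRepresentations
  Literature.NumberTheory.EllipticCurves.ZpExtension Literature.NumberTheory.EllipticCurves.Kobayashi2003
  Literature.NumberTheory.EllipticCurves.Sprung2012 Literature.NumberTheory.EllipticCurves.Sprung2012.Honda
  Literature.NumberTheory.EllipticCurves.Sprung2012.Honda.SprungHonda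
  Summit.BirchSwinnertonDyer.Rank1Residual.F1Sign2

variable {K : Type u} [Field K] {p : ℕ} [hp : Fact p.Prime] (κ : ZpExtension K p)
variable {E : Type u} [Field E] [Algebra K E] (ι : AlgebraicClosure K →ₐ[K] AlgebraicClosure E) (W : WeierstrassCurve K)

/-! ## §1 Orbit propagation through the trace relations, bottom relation with an arbitrary unit -/

/-- **Orbit propagation, arbitrary bottom unit.** Let `c m ∈ E(K_m·E)`, `cneg ∈ E(E)` satisfy
`Tr_{m+1/m} c_{m+1} = a c_m − c_{m−1}` (`m ≥ 1`) and `c_0 = u·cneg` with `u ∈ ℤ` a `p`-adic unit, let `g` restrict to the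
topological generator, `n ≥ 1`, and let `z` be a functional on `E(K_n·E)` with `p^{K} ∣ z(gʲ•c_n)` and `p^{K} ∣ z(gʲ•c_{n−1})` for all
`j < pⁿ`. Then `p^{K} ∣ z(σ•c_m)` for all `σ ∈ Γ_E`, `m ≤ n`, and `p^{K} ∣ z(cneg)`. (The tree's
`SprungHonda.pow_dvd_evalOn_orbit_of_relations` is `u = a − 2`.) [cite: Sprung2012, Thm. 2.2 (p. 1487) (relations (1), (2))]
[cite: Kobayashi2003, Lemma 8.9] -/
theorem pow_dvd_evalOn_orbit_of_relations_of_isUnit {g : Field.absoluteGaloisGroup E} (hg : κ.IsTopGenerator (resGalOfEmb ι g))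
    {ap u : ℤ} (hu : IsUnit ((u : ℤ) : ℤ_[p])) {cneg : localPoints W E} {c : ℕ → localPoints W E}
    (hcneg : cneg ∈ localLayerPointsOfEmb κ ι W 0) (hc : ∀ n, c n ∈ localLayerPointsOfEmb κ ι W n)
    (hR0 : c 0 = u • cneg)
    (hRn : ∀ m : ℕ, 1 ≤ m → localTraceOfEmb κ ι W m (m + 1) (c (m + 1)) = ap • c m - c (m - 1))
    {n : ℕ} (K₀ : ℕ) (z : localLayerPointsOfEmb κ ι W n →+ ℤ_[p])
    (hzn : ∀ j < p ^ n, (p : ℤ_[p]) ^ K₀ ∣ evalOn W (localLayerPointsOfEmb κ ι W n) z (g ^ j • c n))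
    (hzn1 : ∀ j < p ^ n, (p : ℤ_[p]) ^ K₀ ∣ evalOn W (localLayerPointsOfEmb κ ι W n) z (g ^ j • c (n - 1))) :
    (∀ m ≤ n, ∀ σ : Field.absoluteGaloisGroup E,
      (p : ℤ_[p]) ^ K₀ ∣ evalOn W (localLayerPointsOfEmb κ ι W n) z (σ • c m)) ∧
    (p : ℤ_[p]) ^ K₀ ∣ evalOn W (localLayerPointsOfEmb κ ι W n) z cneg := by
  have hmono := localLayerPointsOfEmb_mono κ ι W
  -- all `Γ`-translates of `c_n`, `c_{n−1}` (cosets represented by powers of `g`)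
  have horbn : ∀ σ : Field.absoluteGaloisGroup E, (p : ℤ_[p]) ^ K₀ ∣ evalOn W (localLayerPointsOfEmb κ ι W n) z (σ • c n) := by
    intro σ
    obtain ⟨j, hj, hσ⟩ := exists_smul_eq_pow_smul κ ι W hg (hc n) σ
    rw [hσ]; exact hzn j hj
  have horbn1 : ∀ σ : Field.absoluteGaloisGroup E,
      (p : ℤ_[p]) ^ K₀ ∣ evalOn W (localLayerPointsOfEmb κ ι W n) z (σ • c (n - 1)) := by
    intro σ
    obtain ⟨j, hj, hσ⟩ := exists_smul_eq_pow_smul κ ι W hg (hmono (Nat.sub_le n 1) (hc (n - 1))) σ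
    rw [hσ]; exact hzn1 j hj
  -- downward propagation: `σ•c_{m−1} = a σ•c_m − ∑_{k<p} (σ g^{p^m k})•c_{m+1}`
  have hstep : ∀ m : ℕ, 1 ≤ m → m + 1 ≤ n →
      (∀ σ : Field.absoluteGaloisGroup E, (p : ℤ_[p]) ^ K₀ ∣ evalOn W (localLayerPointsOfEmb κ ι W n) z (σ • c (m + 1))) →
      (∀ σ : Field.absoluteGaloisGroup E, (p : ℤ_[p]) ^ K₀ ∣ evalOn W (localLayerPointsOfEmb κ ι W n) z (σ • c m)) →
      ∀ σ : Field.absoluteGaloisGroup E, (p : ℤ_[p]) ^ K₀ ∣ evalOn W (localLayerPointsOfEmb κ ι W n) z (σ • c (m - 1)) := by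
    intro m hm hmn h1 h0 σ
    have hrel : c (m - 1) = ap • c m - localTraceOfEmb κ ι W m (m + 1) (c (m + 1)) := by
      rw [hRn m hm]; abel
    have htr := localTraceOfEmb_succ_eq_sum_pow_smul κ ι W hg m (hc (m + 1))
    have hcm : σ • c m ∈ (localLayerPointsOfEmb κ ι W n) :=
      hmono (by omega) (smul_mem_localLayerPointsOfEmb κ ι W m σ (hc m))
    have hterm : ∀ k ∈ range p, (σ * g ^ (p ^ m * k)) • c (m + 1) ∈ (localLayerPointsOfEmb κ ι W n) := fun k _ ↦
      hmono hmn (smul_mem_localLayerPointsOfEmb κ ι W (m + 1) _ (hc (m + 1)))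
    rw [hrel, smul_sub, htr, smul_sum, smul_comm σ ap (c m)]
    simp_rw [← mul_smul]
    rw [show ap • σ • c m - ∑ k ∈ range p, (σ * g ^ (p ^ m * k)) • c (m + 1) =
        ap • σ • c m + (-1 : ℤ) • ∑ k ∈ range p, (σ * g ^ (p ^ m * k)) • c (m + 1) by rw [neg_one_zsmul, sub_eq_add_neg],
      evalOn_add_mem W (localLayerPointsOfEmb κ ι W n) z (zsmul_mem hcm ap)
        (zsmul_mem ((localLayerPointsOfEmb κ ι W n).sum_mem hterm) _),
      evalOn_zsmul_mem W (localLayerPointsOfEmb κ ι W n) z hcm,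
      evalOn_zsmul_mem W (localLayerPointsOfEmb κ ι W n) z ((localLayerPointsOfEmb κ ι W n).sum_mem hterm),
      evalOn_sum_mem W (localLayerPointsOfEmb κ ι W n) z _ _ hterm]
    exact dvd_add ((h0 σ).mul_left _) ((dvd_sum fun k _ ↦ h1 _).mul_left _)
  -- induction on `i` for the pair of levels `(n − i, n − i − 1)`
  have hpair : ∀ i : ℕ, i + 1 ≤ n →
      (∀ σ : Field.absoluteGaloisGroup E, (p : ℤ_[p]) ^ K₀ ∣ evalOn W (localLayerPointsOfEmb κ ι W n) z (σ • c (n - i))) ∧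
      (∀ σ : Field.absoluteGaloisGroup E,
        (p : ℤ_[p]) ^ K₀ ∣ evalOn W (localLayerPointsOfEmb κ ι W n) z (σ • c (n - i - 1))) := by
    intro i
    induction i with
    | zero => intro _; exact ⟨by simpa using horbn, by simpa using horbn1⟩
    | succ i ih =>
      intro hi
      obtain ⟨h1, h0⟩ := ih (by omega)
      refine ⟨by simpa [Nat.sub_add_eq] using h0, ?_⟩
      have := hstep (n - i - 1) (by omega) (by omega) (by rwa [show n - i - 1 + 1 = n - i by omega]) h0
      rwa [show n - i - 1 - 1 = n - (i + 1) - 1 by omega] at this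
  have hall : ∀ m ≤ n, ∀ σ : Field.absoluteGaloisGroup E,
      (p : ℤ_[p]) ^ K₀ ∣ evalOn W (localLayerPointsOfEmb κ ι W n) z (σ • c m) := by
    intro m hm σ
    by_cases hmn : m = n
    · subst hmn; exact horbn σ
    · rcases Nat.eq_zero_or_pos n with hn0 | hn0
      · omega
      · have := (hpair (n - m - 1) (by omega)).2 σ
        rwa [show n - (n - m - 1) - 1 = m by omega] at this
  refine ⟨hall, ?_⟩
  -- `cneg` from `c_0 = u·cneg`
  have hcn : cneg ∈ (localLayerPointsOfEmb κ ι W n) := hmono (Nat.zero_le n) hcneg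
  have h0 := hall 0 (Nat.zero_le n) 1
  rw [one_smul, hR0, evalOn_zsmul_mem W (localLayerPointsOfEmb κ ι W n) z hcn] at h0
  exact hu.dvd_mul_left.mp h0

/-! ## §2 `IsHondaSystemAtTwo` from the primal Honda data -/

/-- For `a ∈ {0, ±2}` — indeed for EVERY integer — `a² − 2a − 1` is odd when `a` is even; we only need: `a² − 2a − 1` odd ⟹ a
`2`-adic unit. (Restated from the parity of `a² − 2a − 1 = (a − 1)² − 2`.) [folklore] -/
theorem isUnit_sq_sub_two_mul_sub_one_of_even {a : ℤ} (ha : (2 : ℤ) ∣ a) :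
    IsUnit (((a ^ 2 - 2 * a - 1 : ℤ) : ℤ_[2])) := by
  rw [PadicInt.isUnit_iff]
  have hle : ‖(((a ^ 2 - 2 * a - 1 : ℤ)) : ℤ_[2])‖ ≤ 1 := PadicInt.norm_le_one _
  have hodd : ¬ (2 : ℤ) ∣ a ^ 2 - 2 * a - 1 := by
    obtain ⟨b, rfl⟩ := ha
    have hodd' : Odd ((2 * b) ^ 2 - 2 * (2 * b) - 1) := ⟨2 * b ^ 2 - 2 * b - 1, by ring⟩
    exact fun h ↦ (Int.not_even_iff_odd.mpr hodd') (even_iff_two_dvd.mpr h)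
  have hlt : ¬ ‖(((a ^ 2 - 2 * a - 1 : ℤ)) : ℤ_[2])‖ < 1 := fun h ↦
    hodd (by exact_mod_cast (PadicInt.norm_int_lt_one_iff_dvd _).mp h)
  exact le_antisymm hle (not_lt.mp hlt)

/-- **`IsHondaSystemAtTwo` from the PRIMAL Honda data at `2`.** For `K ⊆ E`, a `ℤ₂`-extension `κ` of `K`, `ι : K̄ → Ē`, `W/K`,
an integer `a` with `a² − 2a − 1` a `2`-adic unit (e.g. `a` even), a local lift `g` of the topological generator, an ODD `N`, and points
`cneg ∈ E(E)`, `c n ∈ E(K_n·E)` with the three relations of `F1Sign2.IsHondaSystemAtTwo` (`c 0 = (a² − 2a − 1)•cneg`,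
`Tr_{1/0} c_1 = a•c_0 + (4 − 2a)•cneg`, `Tr_{n+1/n} c_{n+1} = a•c_n − c_{n−1}` for `n ≥ 1`) and the primal generation clauses
(`N•P ∈ ℤ[Γ_E·c_m] + E(K_{m−1}·E) + 2·E(K_m·E)` for `P ∈ E(K_m·E)`, `m ≥ 1`; `N•P ∈ ℤ·cneg + 2·E(E)` for `P ∈ E(E)`):
`IsHondaSystemAtTwo κ ι W a g cneg c` holds — the four DUAL clauses (injectivity and `2`-saturation at level `0`; `ω_n`-injectivity
and `2`-torsion-free cokernel of `z ↦ (P_{n,c_n}(z), P_{n,c_{n−1}}(z))` at level `n ≥ 1`) follow by the divisibility engine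
`SprungHonda.pow_dvd_evalOn_of_generation` and §1. The `p = 2` twin of `SprungHonda.isHondaSystem_of_primal`.
[cite: Sprung2012, Thm. 2.2 (p. 1487) and Cor. 2.10 (p. 1489)] [cite: Kobayashi2003, Prop. 8.12] -/
theorem isHondaSystemAtTwo_of_primal (κ : ZpExtension K 2) {ap : ℤ} (hap : IsUnit (((ap ^ 2 - 2 * ap - 1 : ℤ)) : ℤ_[2]))
    {g : Field.absoluteGaloisGroup E} (hg : κ.IsTopGenerator (resGalOfEmb ι g)) {N : ℕ} (hN : N.Coprime 2)
    {cneg : localPoints W E} {c : ℕ → localPoints W E}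
    (hcneg : cneg ∈ localLayerPointsOfEmb κ ι W 0) (hc : ∀ n, c n ∈ localLayerPointsOfEmb κ ι W n)
    (hR0 : c 0 = (ap ^ 2 - 2 * ap - 1) • cneg)
    (hR1 : localTraceOfEmb κ ι W 0 1 (c 1) = ap • c 0 + (4 - 2 * ap) • cneg)
    (hRn : ∀ n : ℕ, 1 ≤ n → localTraceOfEmb κ ι W n (n + 1) (c (n + 1)) = ap • c n - c (n - 1))
    (hGEN : ∀ m : ℕ, 1 ≤ m → ∀ P ∈ localLayerPointsOfEmb κ ι W m,
      ∃ B ∈ AddSubgroup.closure (Set.range fun σ : Field.absoluteGaloisGroup E ↦ σ • c m),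
        ∃ P' ∈ localLayerPointsOfEmb κ ι W (m - 1), ∃ R ∈ localLayerPointsOfEmb κ ι W m, N • P = B + P' + 2 • R)
    (hGEN0 : ∀ P ∈ localLayerPointsOfEmb κ ι W 0,
      ∃ u : ℤ, ∃ R ∈ localLayerPointsOfEmb κ ι W 0, N • P = u • cneg + 2 • R) :
    IsHondaSystemAtTwo κ ι W ap g cneg c := by
  -- the level-`0` engine: divisibility on `Γ·c_0 = {c_0}` and `cneg` suffices
  have hc0fix : ∀ σ : Field.absoluteGaloisGroup E, σ • c 0 = c 0 := (mem_localLayerPointsOfEmb_zero_iff κ ι W _).mp (hc 0)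
  have core0 : ∀ (K₀ : ℕ) (z : localLayerPointsOfEmb κ ι W 0 →+ ℤ_[2]),
      ((2 : ℕ) : ℤ_[2]) ^ K₀ ∣ evalOn W (localLayerPointsOfEmb κ ι W 0) z cneg →
      ∀ P ∈ localLayerPointsOfEmb κ ι W 0, ((2 : ℕ) : ℤ_[2]) ^ K₀ ∣ evalOn W (localLayerPointsOfEmb κ ι W 0) z P := by
    intro K₀ z hneg
    refine pow_dvd_evalOn_of_generation κ ι W hN hcneg hc hGEN hGEN0 0 K₀ z ?_ hneg
    intro m hm σ
    obtain rfl : m = 0 := Nat.le_zero.mp hm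
    rw [hc0fix, hR0, evalOn_zsmul_mem W _ z hcneg]
    exact hneg.mul_left _
  -- the level-`n` engine
  have coren : ∀ {n : ℕ}, 1 ≤ n → ∀ (K₀ : ℕ) (z : localLayerPointsOfEmb κ ι W n →+ ℤ_[2]),
      (∀ j < 2 ^ n, ((2 : ℕ) : ℤ_[2]) ^ K₀ ∣ evalOn W (localLayerPointsOfEmb κ ι W n) z (g ^ j • c n)) →
      (∀ j < 2 ^ n, ((2 : ℕ) : ℤ_[2]) ^ K₀ ∣ evalOn W (localLayerPointsOfEmb κ ι W n) z (g ^ j • c (n - 1))) →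
      ∀ P ∈ localLayerPointsOfEmb κ ι W n, ((2 : ℕ) : ℤ_[2]) ^ K₀ ∣ evalOn W (localLayerPointsOfEmb κ ι W n) z P := by
    intro n _ K₀ z hzn hzn1
    obtain ⟨horb, hneg⟩ :=
      pow_dvd_evalOn_orbit_of_relations_of_isUnit κ ι W hg hap hcneg hc hR0 hRn K₀ z hzn hzn1
    exact pow_dvd_evalOn_of_generation κ ι W hN hcneg hc hGEN hGEN0 n K₀ z horb hneg
  have h2 : ((2 : ℕ) : ℤ_[2]) = 2 := by norm_num
  refine ⟨hcneg, hc, hR0, hR1, hRn, ?_, ?_, ?_, ?_⟩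
  · -- level `0`, injectivity
    intro z hz
    ext ⟨P, hP⟩
    rw [AddMonoidHom.zero_apply]
    refine padicInt_eq_zero_of_forall_pow_dvd fun K₀ ↦ ?_
    have := core0 K₀ z (by rw [hz]; exact dvd_zero _) P hP
    rwa [evalOn_of_mem W _ z hP] at this
  · -- level `0`, `2`-saturation
    rintro a ⟨z, hz⟩
    have hdiv : ∀ P : localLayerPointsOfEmb κ ι W 0, ((2 : ℕ) : ℤ_[2]) ∣ z P := by
      rintro ⟨P, hP⟩
      have := core0 1 z (by rw [hz, pow_one, h2]; exact dvd_mul_right _ _) P hP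
      rwa [pow_one, evalOn_of_mem W _ z hP] at this
    obtain ⟨y, rfl⟩ := exists_eq_smul_of_forall_dvd z hdiv
    refine ⟨y, ?_⟩
    have hp0 : ((2 : ℕ) : ℤ_[2]) ≠ 0 := by norm_num
    apply mul_left_cancel₀ hp0
    rw [h2, ← hz, evalOn_of_mem W _ _ hcneg, evalOn_of_mem W _ _ hcneg, AddMonoidHom.smul_apply, smul_eq_mul, h2]
  · -- level `n ≥ 1`, injectivity
    intro n hn z h1 h1'
    rw [pairingSum_def] at h1 h1'
    have e1 := forall_eq_zero_of_omega_dvd_sum h1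
    have e2 := forall_eq_zero_of_omega_dvd_sum h1'
    ext ⟨P, hP⟩
    rw [AddMonoidHom.zero_apply]
    refine padicInt_eq_zero_of_forall_pow_dvd fun K₀ ↦ ?_
    have := coren hn K₀ z (fun j hj ↦ by rw [e1 j hj]; exact dvd_zero _) (fun j hj ↦ by rw [e2 j hj]; exact dvd_zero _) P hP
    rwa [evalOn_of_mem W _ z hP] at this
  · -- level `n ≥ 1`, `2`-torsion-free cokernel
    rintro n hn a b ⟨z, ha, hb⟩
    rw [pairingSum_def] at ha hb
    have ha' := ha
    have hb' := hb
    rw [← h2] at ha' hb'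
    have d1 := forall_dvd_of_omega_dvd_C_mul_sub_sum ha'
    have d2 := forall_dvd_of_omega_dvd_C_mul_sub_sum hb'
    have hdiv : ∀ P : localLayerPointsOfEmb κ ι W n, ((2 : ℕ) : ℤ_[2]) ∣ z P := by
      rintro ⟨P, hP⟩
      have := coren hn 1 z (fun j hj ↦ by rw [pow_one]; exact d1 j hj) (fun j hj ↦ by rw [pow_one]; exact d2 j hj) P hP
      rwa [pow_one, evalOn_of_mem W _ z hP] at this
    obtain ⟨y, rfl⟩ := exists_eq_smul_of_forall_dvd z hdiv
    refine ⟨y, ?_, ?_⟩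
    · refine omega_dvd_of_omega_dvd_C_mul ?_
      rw [h2, mul_sub, ← pairingSum_smul, pairingSum_def]
      rw [h2] at ha
      exact ha
    · refine omega_dvd_of_omega_dvd_C_mul ?_
      rw [h2, mul_sub, ← pairingSum_smul, pairingSum_def]
      rw [h2] at hb
      exact hb

end Summit.BirchSwinnertonDyer.BirchSwinnertonDyer.Theorems.SSHondaTwo

end
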